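import Literature.Analysis.FluidPDE.LeslieShvydkoy2018EnergyFlux
import Literature.Analysis.FluidPDE.SerrinEnstrophyGronwall
import HarnessLib

/-!
# Leslie–Shvydkoy 2018, Prop. 3.2 / 4.2: Lemma 3.6 (one energy step), its dyadic rescaling and
# the Grönwall closure

Analysis/FluidPDE proofs file (theorems only; no definitions, no named facts) on the discharge
path of the named fact `Literature.Analysis.FluidPDE.leslieShvydkoy2018_morreyBound`
(`LeslieShvydkoy2018MorreyBound.lean`; T. M. Leslie, R. Shvydkoy, ARMA 230 (2018) =
arXiv:1705.04420, Prop. 3.2 + 4.2). For a classical solution of the unforced Navier–Stokes system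
on an open time set `S` whose pressure is gauged to the normalised pressure at a.e. time and
whose velocity obeys `‖u(τ)‖_{L^∞} ≤ f(τ)`, it renders

* **Lemma 3.6 / (4.1)** (`exists_ballEnergySq_step`): for `[s, t] ⊆ S` and every ball,
  `∫_{B(x₀,ρ)} |u(t)|² ≤ ∫_{B(x₀,2ρ)} |u(s)|² + ∫_s^t K (|ν|/ρ² + f(τ)/ρ) W_ρ(u(τ)) dτ`
  (the local energy identity against `cutoff ρ (· - x₀)` with the dissipation dropped,
  `IsClassicalNSSolutionOn.integral_cutoff_norm_sq_sub_le`, and the slice flux bound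
  `exists_flux_cutoff_le`; in print `E(t,r) ≤ rⁿ f(s)² + (C₀/r) ∫_s^t f(τ) Σ_j 2^{-j} E_j(τ,r) dτ`
  plus, for Navier–Stokes, the viscous term `C|s| r⁻¹` of (4.1), here kept as `|ν| r⁻² ∫ W`);
* **(3.12')** (`exists_dyadicEnergySup_step`): the rescaled steps `E_k(t,r) ≤ …` combined into one
  inequality for the dyadic supremum,
  `W_R(u(t)) ≤ 8 W_R(u(s)) + ∫_s^t K (|ν|/R² + f(τ)/R) W_R(u(τ)) dτ`;
* **(3.13)–(3.14)** (`exists_dyadicEnergySup_le_exp`): the printed `M`-fold iteration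
  `E(t,r) ≤ rⁿ f(t₀)² Σ_{j<M} C₁ʲ/j! + (C₁ᴹ/M!)‖u‖²_{L^∞L²}`, `M → ∞`, replaced by Grönwall's lemma
  in integral form (the tree's `lintegral_gronwall_le`, Robinson–Rodrigo–Sadowski Lemma A.25):
  `W_R(u(t)) ≤ 8 W_R(u(s)) exp(∫_s^t K (|ν|/R² + f/R))` on every window `[s, t₁] ⊆ S` on which
  `W_R(u(·))` is bounded (the finite energy) and `f` is integrable.

## References

* T. M. Leslie, R. Shvydkoy, ARMA 230 (2018) = arXiv:1705.04420, §3.4 Lemma 3.6, (3.11')–(3.14)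
  (pp. 10–12) and §4 (4.1)–(4.2) (p. 13). [`LeslieShvydkoy2017`]
* J. C. Robinson, J. L. Rodrigo, W. Sadowski, *The three-dimensional Navier–Stokes equations*
  (2016), Lemma A.25 (Grönwall in integral form). [`RobinsonRodrigoSadowski2016`]
-/

noncomputable section

open MeasureTheory Set Metric Filter Function InnerProductSpace
open _root_.Topology
open scoped ENNReal NNReal RealInnerProductSpace Laplacian ContDiff

namespace Literature.Analysis.FluidPDE

namespace LeslieShvydkoy2018

/-! ### Tools -/

/-- `ofReal (∫ g) ≤ ∫⁻ ofReal g` for every real function (no integrability needed: a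
non-integrable `g` has integral `0`). [folklore] -/
private theorem ofReal_integral_le_lintegral_ofReal' {α : Type*} [MeasurableSpace α]
    {μ : Measure α} (g : α → ℝ) :
    ENNReal.ofReal (∫ x, g x ∂μ) ≤ ∫⁻ x, ENNReal.ofReal (g x) ∂μ := by
  by_cases hgi : Integrable g μ
  · have hmax : ∀ x, ENNReal.ofReal (max (g x) 0) = ENNReal.ofReal (g x) := by
      intro x
      rcases le_total (g x) 0 with hx | hx
      · rw [max_eq_right hx, ENNReal.ofReal_zero, ENNReal.ofReal_of_nonpos hx]
      · rw [max_eq_left hx]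
    calc ENNReal.ofReal (∫ x, g x ∂μ) ≤ ENNReal.ofReal (∫ x, max (g x) 0 ∂μ) :=
          ENNReal.ofReal_le_ofReal (integral_mono hgi hgi.pos_part fun x => le_max_left _ _)
      _ = ∫⁻ x, ENNReal.ofReal (max (g x) 0) ∂μ :=
          ofReal_integral_eq_lintegral_ofReal hgi.pos_part
            (Eventually.of_forall fun x => le_max_right _ _)
      _ = ∫⁻ x, ENNReal.ofReal (g x) ∂μ := lintegral_congr hmax
  · rw [integral_undef hgi, ENNReal.ofReal_zero]; exact bot_le

/-- **Grönwall's lemma in integral form on `[T₀, T₁]`** (the tree's `lintegral_gronwall_le`,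
Robinson–Rodrigo–Sadowski Lemma A.25, translated in time): if `φ ≤ M < ∞` on `[T₀, T₁]`,
`∫_{]T₀,T₁[} a < ∞`, `B < ∞` and `φ(t) ≤ B + ∫_{]T₀,t[} a φ` on `[T₀, T₁]`, then
`φ(t) ≤ B exp(∫_{]T₀,t[} a)` there. [cite: RobinsonRodrigoSadowski2016, Lemma A.25] -/
private theorem lintegral_gronwall_le_Icc {T₀ T₁ : ℝ} {φ a : ℝ → ℝ≥0∞} {B M : ℝ≥0∞} (hB : B ≠ ⊤)
    (hM : M ≠ ⊤) (hφM : ∀ t ∈ Icc T₀ T₁, φ t ≤ M) (ha : ∫⁻ t in Ioo T₀ T₁, a t ≠ ⊤)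
    (hφ : ∀ t ∈ Icc T₀ T₁, φ t ≤ B + ∫⁻ s in Ioo T₀ t, a s * φ s) :
    ∀ t ∈ Icc T₀ T₁, φ t ≤ B * ENNReal.ofReal (Real.exp (∫⁻ s in Ioo T₀ t, a s).toReal) := by
  have hshift : ∀ (g : ℝ → ℝ≥0∞) (τ : ℝ),
      ∫⁻ s in Ioo 0 τ, g (T₀ + s) = ∫⁻ s in Ioo T₀ (T₀ + τ), g s := by
    intro g τ
    have hmp : MeasurePreserving (fun s : ℝ => T₀ + s) volume volume :=
      measurePreserving_add_left volume T₀
    have hemb : MeasurableEmbedding fun s : ℝ => T₀ + s :=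
      (Homeomorph.addLeft T₀).measurableEmbedding
    have h := hmp.setLIntegral_comp_preimage_emb hemb g (Ioo T₀ (T₀ + τ))
    rwa [Set.preimage_const_add_Ioo, sub_self, add_sub_cancel_left] at h
  intro t ht
  have key := lintegral_gronwall_le (S := T₁ - T₀) (φ := fun τ => φ (T₀ + τ))
    (a := fun τ => a (T₀ + τ)) (B := B) (M := M) hB hM ?_ ?_ ?_ (t - T₀)
    ⟨sub_nonneg.2 ht.1, sub_le_sub_right ht.2 _⟩
  · rwa [hshift a (t - T₀), add_sub_cancel] at key
  · intro τ hτ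
    exact hφM (T₀ + τ) ⟨by linarith [hτ.1], by linarith [hτ.2]⟩
  · rw [hshift a (T₁ - T₀), add_sub_cancel]
    exact ha
  · intro τ hτ
    have h := hφ (T₀ + τ) ⟨by linarith [hτ.1], by linarith [hτ.2]⟩
    rwa [← hshift (fun s => a s * φ s) τ] at h

/-- `W_{2^k R} ≤ 8^k W_R` (iterated rescaling (3.11')). [cite: LeslieShvydkoy2017, §3.4 (3.11') (p. 11)] -/
theorem dyadicEnergySup_pow_mul_le {v : EuclideanSpace ℝ (Fin 3) → EuclideanSpace ℝ (Fin 3)}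
    {x₀ : EuclideanSpace ℝ (Fin 3)} {R : ℝ} (k : ℕ) :
    dyadicEnergySup v x₀ (2 ^ k * R) ≤ 8 ^ k * dyadicEnergySup v x₀ R := by
  induction k with
  | zero => simp
  | succ k ih =>
    calc dyadicEnergySup v x₀ (2 ^ (k + 1) * R) = dyadicEnergySup v x₀ (2 * (2 ^ k * R)) := by
          ring_nf
      _ ≤ 8 * dyadicEnergySup v x₀ (2 ^ k * R) := dyadicEnergySup_two_mul_le
      _ ≤ 8 * (8 ^ k * dyadicEnergySup v x₀ R) := by gcongr
      _ = 8 ^ (k + 1) * dyadicEnergySup v x₀ R := by ring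

/-! ### Lemma 3.6 / (4.1): one energy step -/

/-- **Leslie–Shvydkoy Lemma 3.6 with the viscous term of (4.1): one energy step.** There is an
absolute `K` such that: for a classical solution `(u, p)` of the unforced Navier–Stokes system
(`ν ≥ 0`) on an open time set `S`, with the pressure gauged to the normalised pressure at a.e.
time (`p(τ) - c(τ) = p̃[u(τ)]`), `u(τ) ∈ L²` and `‖u(τ)‖ ≤ f(τ)` for `τ ∈ S`, every window
`[s, t] ⊆ S`, centre `x₀` and radius `ρ > 0`:
`∫_{B(x₀,ρ)} |u(t)|² ≤ ∫_{B(x₀,2ρ)} |u(s)|² + ∫_{]s,t[} K (|ν|/ρ² + f(τ)/ρ) W_ρ(u(τ)) dτ`.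
(In print: `E(t,r) ≤ E(s,r) + (C/r)∫_s^t ∫_{B_r} |u|³ + |p-(p)_r||u|`, then the slice bounds;
(4.1) for the viscous term.) [cite: LeslieShvydkoy2017, §3.4 Lemma 3.6 and (3.12) (pp. 10–11); §4 (4.1) (p. 13)] -/
theorem exists_ballEnergySq_step :
    ∃ K : ℝ≥0, ∀ (S : Set ℝ) (ν : ℝ) (u : ℝ → EuclideanSpace ℝ (Fin 3) → EuclideanSpace ℝ (Fin 3))
      (p : ℝ → EuclideanSpace ℝ (Fin 3) → ℝ) (f : ℝ → ℝ), IsClassicalNSSolutionOn S ν 0 u p →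
      IsOpen S → 0 ≤ ν →
      (∀ᵐ τ ∂(volume.restrict S), ∃ c : ℝ, ∀ x, p τ x - c = normalisedPressure (u τ) x) →
      (∀ τ ∈ S, MemLp (u τ) 2 volume) → (∀ τ ∈ S, ∀ x, ‖u τ x‖ ≤ f τ) →
      ∀ (x₀ : EuclideanSpace ℝ (Fin 3)) (ρ s t : ℝ), 0 < ρ → s ≤ t → Icc s t ⊆ S →
        ∫⁻ y in ball x₀ ρ, ‖u t y‖ₑ ^ 2 ≤
          (∫⁻ y in ball x₀ (2 * ρ), ‖u s y‖ₑ ^ 2) +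
            ∫⁻ τ in Ioo s t, K * (ENNReal.ofReal (|ν| / ρ ^ 2) + ENNReal.ofReal (f τ / ρ)) *
              dyadicEnergySup (u τ) x₀ ρ := by
  obtain ⟨K, hK⟩ := exists_flux_cutoff_le
  refine ⟨K, fun S ν u p f hsol hS hν hgauge hL2 hf x₀ ρ s t hρ hst hI => ?_⟩
  -- the cut-off
  set φ : EuclideanSpace ℝ (Fin 3) → ℝ := fun y => cutoff ρ (y - x₀) with hφdef
  have hφs : ContDiff ℝ ∞ φ := contDiff_cutoff_translate x₀ ρ
  have hφc : HasCompactSupport φ := hasCompactSupport_cutoff_translate hρ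
  have hφ0 : ∀ x, 0 ≤ φ x := fun x => cutoff_nonneg ρ (x - x₀)
  have hφ1 : ∀ x, φ x ≤ 1 := fun x => cutoff_le_one ρ (x - x₀)
  -- the energy identity with the dissipation dropped
  have h1 := hsol.integral_cutoff_norm_sq_sub_le hS hν hφs hφc hφ0 hst hI
  set e : ℝ → ℝ := fun τ => ∫ x, φ x * ‖u τ x‖ ^ 2 with he
  set Φ : ℝ → ℝ := fun τ => ∫ x, (ν * ((Δ φ) x * ‖u τ x‖ ^ 2) +
    fderiv ℝ φ x (u τ x) * ‖u τ x‖ ^ 2 + 2 * (p τ x * fderiv ℝ φ x (u τ x))) with hΦ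
  have h1' : e t ≤ e s + ∫ τ in Ioo s t, Φ τ := by
    have : (∫ τ in s..t, Φ τ) = ∫ τ in Ioo s t, Φ τ := by
      rw [intervalIntegral.integral_of_le hst, integral_Ioc_eq_integral_Ioo]
    have h := h1
    rw [this] at h
    linarith
  -- continuity at the end times
  have htS : t ∈ S := hI (right_mem_Icc.2 hst)
  have hsS : s ∈ S := hI (left_mem_Icc.2 hst)
  have hut : Continuous (u t) := (hsol.contDiff_velocity htS).continuous
  have hus : Continuous (u s) := (hsol.contDiff_velocity hsS).continuous
  have hφcont : Continuous φ := hφs.continuous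
  -- lower bound at time `t`: the ball `B(x₀, ρ)` where `φ = 1`
  have hlow : ∫⁻ y in ball x₀ ρ, ‖u t y‖ₑ ^ 2 ≤ ENNReal.ofReal (e t) := by
    have hball : IntegrableOn (fun x => ‖u t x‖ ^ 2) (ball x₀ ρ) volume :=
      ((hut.norm.pow 2).continuousOn.integrableOn_compact (isCompact_closedBall x₀ ρ)).mono_set
        ball_subset_closedBall
    have hφu : Integrable (fun x => φ x * ‖u t x‖ ^ 2) volume :=
      (hφcont.mul (hut.norm.pow 2)).integrable_of_hasCompactSupport hφc.mul_right
    have hle : ∫ x in ball x₀ ρ, ‖u t x‖ ^ 2 ≤ e t := by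
      rw [he, ← integral_indicator measurableSet_ball]
      refine integral_mono (hball.integrable_indicator measurableSet_ball) hφu fun x => ?_
      by_cases hx : x ∈ ball x₀ ρ
      · rw [indicator_of_mem hx, show φ x = 1 from cutoff_translate_eq_one hρ hx, one_mul]
      · rw [indicator_of_notMem hx]; exact mul_nonneg (hφ0 x) (sq_nonneg _)
    have heq : ∫⁻ y in ball x₀ ρ, ‖u t y‖ₑ ^ 2 = ENNReal.ofReal (∫ x in ball x₀ ρ, ‖u t x‖ ^ 2) := by
      rw [ofReal_integral_eq_lintegral_ofReal hball (ae_of_all _ fun x => sq_nonneg _)]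
      refine lintegral_congr fun x => ?_
      rw [← ofReal_norm, ← ENNReal.ofReal_pow (norm_nonneg _)]
    rw [heq]
    exact ENNReal.ofReal_le_ofReal hle
  -- upper bound at time `s`: the ball `B(x₀, 2ρ)` containing the support
  have hup : ENNReal.ofReal (e s) ≤ ∫⁻ y in ball x₀ (2 * ρ), ‖u s y‖ₑ ^ 2 := by
    have hball : IntegrableOn (fun x => ‖u s x‖ ^ 2) (ball x₀ (2 * ρ)) volume :=
      ((hus.norm.pow 2).continuousOn.integrableOn_compact (isCompact_closedBall x₀ (2 * ρ))).mono_set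
        ball_subset_closedBall
    have hφu : Integrable (fun x => φ x * ‖u s x‖ ^ 2) volume :=
      (hφcont.mul (hus.norm.pow 2)).integrable_of_hasCompactSupport hφc.mul_right
    have hle : e s ≤ ∫ x in ball x₀ (2 * ρ), ‖u s x‖ ^ 2 := by
      rw [he, ← integral_indicator measurableSet_ball]
      refine integral_mono hφu (hball.integrable_indicator measurableSet_ball) fun x => ?_
      by_cases hx : x ∈ ball x₀ (2 * ρ)
      · rw [indicator_of_mem hx]
        exact mul_le_of_le_one_left (sq_nonneg _) (hφ1 x)
      · rw [indicator_of_notMem hx, show φ x = 0 from cutoff_translate_eq_zero hρ hx, zero_mul]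
    have heq : ∫⁻ y in ball x₀ (2 * ρ), ‖u s y‖ₑ ^ 2 =
        ENNReal.ofReal (∫ x in ball x₀ (2 * ρ), ‖u s x‖ ^ 2) := by
      rw [ofReal_integral_eq_lintegral_ofReal hball (ae_of_all _ fun x => sq_nonneg _)]
      refine lintegral_congr fun x => ?_
      rw [← ofReal_norm, ← ENNReal.ofReal_pow (norm_nonneg _)]
    rw [heq]
    exact ENNReal.ofReal_le_ofReal hle
  -- the flux, a.e. in time
  have hflux : ENNReal.ofReal (∫ τ in Ioo s t, Φ τ) ≤
      ∫⁻ τ in Ioo s t, K * (ENNReal.ofReal (|ν| / ρ ^ 2) + ENNReal.ofReal (f τ / ρ)) *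
        dyadicEnergySup (u τ) x₀ ρ := by
    refine (ofReal_integral_le_lintegral_ofReal' Φ).trans (lintegral_mono_ae ?_)
    have hIoo : Ioo s t ⊆ S := fun τ hτ => hI (Ioo_subset_Icc_self hτ)
    filter_upwards [ae_restrict_of_ae_restrict_of_subset hIoo hgauge,
      ae_restrict_mem measurableSet_Ioo] with τ hτg hτ
    obtain ⟨c, hc⟩ := hτg
    exact hK S ν u p hsol τ (hIoo hτ) c (f τ) hc (hL2 τ (hIoo hτ)) (hf τ (hIoo hτ)) x₀ ρ hρ
  -- assemble
  have he0 : 0 ≤ e s := integral_nonneg fun x => mul_nonneg (hφ0 x) (sq_nonneg _)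
  calc ∫⁻ y in ball x₀ ρ, ‖u t y‖ₑ ^ 2 ≤ ENNReal.ofReal (e t) := hlow
    _ ≤ ENNReal.ofReal (e s + ∫ τ in Ioo s t, Φ τ) := ENNReal.ofReal_le_ofReal h1'
    _ ≤ ENNReal.ofReal (e s) + ENNReal.ofReal (∫ τ in Ioo s t, Φ τ) := ENNReal.ofReal_add_le
    _ ≤ _ := add_le_add hup hflux

/-! ### (3.12'): the step for the dyadic supremum -/

/-- **The rescaled steps combined** (Leslie–Shvydkoy (3.11')–(3.12'): "We can therefore rescale
the bound (3.12) … it suffices to use a rougher bound, where we trivially replace the sum above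
with a sum over all of `ℕ`"). With the constant `K` of the one-step inequality: for every window
`[s, t] ⊆ S`, centre `x₀` and `R > 0`,
`W_R(u(t)) ≤ 8 W_R(u(s)) + ∫_{]s,t[} K (|ν|/R² + f(τ)/R) W_R(u(τ)) dτ`.
[cite: LeslieShvydkoy2017, §3.4 (3.11')–(3.12') (p. 11)] -/
theorem exists_dyadicEnergySup_step :
    ∃ K : ℝ≥0, ∀ (S : Set ℝ) (ν : ℝ) (u : ℝ → EuclideanSpace ℝ (Fin 3) → EuclideanSpace ℝ (Fin 3))
      (p : ℝ → EuclideanSpace ℝ (Fin 3) → ℝ) (f : ℝ → ℝ), IsClassicalNSSolutionOn S ν 0 u p →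
      IsOpen S → 0 ≤ ν →
      (∀ᵐ τ ∂(volume.restrict S), ∃ c : ℝ, ∀ x, p τ x - c = normalisedPressure (u τ) x) →
      (∀ τ ∈ S, MemLp (u τ) 2 volume) → (∀ τ ∈ S, ∀ x, ‖u τ x‖ ≤ f τ) →
      ∀ (x₀ : EuclideanSpace ℝ (Fin 3)) (R s t : ℝ), 0 < R → s ≤ t → Icc s t ⊆ S →
        dyadicEnergySup (u t) x₀ R ≤
          8 * dyadicEnergySup (u s) x₀ R +
            ∫⁻ τ in Ioo s t, K * (ENNReal.ofReal (|ν| / R ^ 2) + ENNReal.ofReal (f τ / R)) *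
              dyadicEnergySup (u τ) x₀ R := by
  obtain ⟨K, hK⟩ := exists_ballEnergySq_step
  refine ⟨K, fun S ν u p f hsol hS hν hgauge hL2 hf x₀ R s t hR hst hI => ?_⟩
  have hIS : ∀ τ ∈ Ioo s t, τ ∈ S := fun τ hτ => hI (Ioo_subset_Icc_self hτ)
  -- the kernel at the base scale dominates the kernels at the dyadic scales
  set a : ℝ → ℝ≥0∞ := fun τ => K * (ENNReal.ofReal (|ν| / R ^ 2) + ENNReal.ofReal (f τ / R))
    with ha
  refine iSup_le fun k => ?_
  have hρ : (0 : ℝ) < 2 ^ k * R := by positivity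
  have h2k : (1 : ℝ) ≤ 2 ^ k := one_le_pow₀ (by norm_num)
  have h8 : (8 : ℝ≥0∞) ^ k ≠ 0 := pow_ne_zero _ (by norm_num)
  have h8' : (8 : ℝ≥0∞) ^ k ≠ ⊤ := ENNReal.pow_ne_top (by norm_num)
  have step := hK S ν u p f hsol hS hν hgauge hL2 hf x₀ (2 ^ k * R) s t hρ hst hI
  -- kernel comparison
  have hker : ∀ τ ∈ Ioo s t,
      K * (ENNReal.ofReal (|ν| / (2 ^ k * R) ^ 2) + ENNReal.ofReal (f τ / (2 ^ k * R))) *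
        dyadicEnergySup (u τ) x₀ (2 ^ k * R) ≤ a τ * (8 ^ k * dyadicEnergySup (u τ) x₀ R) := by
    intro τ hτ
    have hf0 : 0 ≤ f τ := (norm_nonneg _).trans (hf τ (hIS τ hτ) x₀)
    have hk1 : ENNReal.ofReal (|ν| / (2 ^ k * R) ^ 2) ≤ ENNReal.ofReal (|ν| / R ^ 2) := by
      refine ENNReal.ofReal_le_ofReal (div_le_div_of_nonneg_left (abs_nonneg _) (by positivity) ?_)
      rw [mul_pow]
      exact le_mul_of_one_le_left (by positivity) (one_le_pow₀ h2k)
    have hk2 : ENNReal.ofReal (f τ / (2 ^ k * R)) ≤ ENNReal.ofReal (f τ / R) :=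
      ENNReal.ofReal_le_ofReal (div_le_div_of_nonneg_left hf0 hR
        (le_mul_of_one_le_left hR.le h2k))
    calc K * (ENNReal.ofReal (|ν| / (2 ^ k * R) ^ 2) + ENNReal.ofReal (f τ / (2 ^ k * R))) *
          dyadicEnergySup (u τ) x₀ (2 ^ k * R)
        ≤ K * (ENNReal.ofReal (|ν| / R ^ 2) + ENNReal.ofReal (f τ / R)) *
          (8 ^ k * dyadicEnergySup (u τ) x₀ R) := by
          gcongr
          exact dyadicEnergySup_pow_mul_le k
      _ = a τ * (8 ^ k * dyadicEnergySup (u τ) x₀ R) := by rw [ha]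
  -- divide the step by `8^k`
  have hdiv : (∫⁻ y in ball x₀ (2 ^ k * R), ‖u t y‖ₑ ^ 2) / 8 ^ k ≤
      (∫⁻ y in ball x₀ (2 * (2 ^ k * R)), ‖u s y‖ₑ ^ 2) / 8 ^ k +
        (∫⁻ τ in Ioo s t, a τ * (8 ^ k * dyadicEnergySup (u τ) x₀ R)) / 8 ^ k := by
    rw [ENNReal.div_eq_inv_mul, ENNReal.div_eq_inv_mul, ENNReal.div_eq_inv_mul, ← mul_add]
    gcongr
    refine step.trans (add_le_add le_rfl (setLIntegral_mono' measurableSet_Ioo hker))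
  -- the two terms
  have hfirst : (∫⁻ y in ball x₀ (2 * (2 ^ k * R)), ‖u s y‖ₑ ^ 2) / 8 ^ k ≤
      8 * dyadicEnergySup (u s) x₀ R := by
    have hrad : (2 : ℝ) * (2 ^ k * R) = 2 ^ (k + 1) * R := by ring
    rw [hrad]
    have h := ballEnergySq_div_le_dyadicEnergySup (v := u s) (x₀ := x₀) (R := R) (k + 1)
    have e : (∫⁻ y in ball x₀ (2 ^ (k + 1) * R), ‖u s y‖ₑ ^ 2) / 8 ^ k =
        8 * ((∫⁻ y in ball x₀ (2 ^ (k + 1) * R), ‖u s y‖ₑ ^ 2) / 8 ^ (k + 1)) := by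
      rw [ENNReal.div_eq_inv_mul, ENNReal.div_eq_inv_mul, ← mul_assoc]
      congr 1
      rw [pow_succ, ENNReal.mul_inv (Or.inl h8) (Or.inl h8'), mul_comm ((8 : ℝ≥0∞) ^ k)⁻¹ 8⁻¹,
        ← mul_assoc, ENNReal.mul_inv_cancel (by norm_num) (by norm_num), one_mul]
    rw [e]
    gcongr
  have hsecond : (∫⁻ τ in Ioo s t, a τ * (8 ^ k * dyadicEnergySup (u τ) x₀ R)) / 8 ^ k =
      ∫⁻ τ in Ioo s t, a τ * dyadicEnergySup (u τ) x₀ R := by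
    rw [ENNReal.div_eq_inv_mul, ← lintegral_const_mul' _ _ (ENNReal.inv_ne_top.2 h8)]
    refine lintegral_congr fun τ => ?_
    calc ((8 : ℝ≥0∞) ^ k)⁻¹ * (a τ * (8 ^ k * dyadicEnergySup (u τ) x₀ R))
        = (((8 : ℝ≥0∞) ^ k)⁻¹ * 8 ^ k) * (a τ * dyadicEnergySup (u τ) x₀ R) := by ring
      _ = a τ * dyadicEnergySup (u τ) x₀ R := by rw [ENNReal.inv_mul_cancel h8 h8', one_mul]
  calc (∫⁻ y in ball x₀ (2 ^ k * R), ‖u t y‖ₑ ^ 2) / 8 ^ k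
      ≤ (∫⁻ y in ball x₀ (2 * (2 ^ k * R)), ‖u s y‖ₑ ^ 2) / 8 ^ k +
        (∫⁻ τ in Ioo s t, a τ * (8 ^ k * dyadicEnergySup (u τ) x₀ R)) / 8 ^ k := hdiv
    _ ≤ 8 * dyadicEnergySup (u s) x₀ R + ∫⁻ τ in Ioo s t, a τ * dyadicEnergySup (u τ) x₀ R := by
        rw [hsecond]; exact add_le_add hfirst le_rfl

/-! ### (3.13)–(3.14): the Grönwall closure -/

/-- **Leslie–Shvydkoy (3.14) with `M → ∞`, via Grönwall.** With the constant `K` of the dyadic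
step: for a classical solution as above whose slices have energy `∫ |u(τ)|² ≤ E₀ < ∞` on `S`,
every window `[s, t₁] ⊆ S` on which `f` is integrable, every centre `x₀`, `R > 0` and
`t ∈ [s, t₁]`,
`W_R(u(t)) ≤ 8 W_R(u(s)) · exp(∫_{]s,t[} K (|ν|/R² + f(τ)/R) dτ)`
(in print: `E(t,r) ≤ rⁿ f(t₀)² e^{C₁}` after `M → ∞` in (3.14), with `C₁ = C₀ c₀ q'` the bound
(3.13) of the kernel integral). [cite: LeslieShvydkoy2017, §3.4 (3.13)–(3.14) (pp. 11–12); RobinsonRodrigoSadowski2016, Lemma A.25] -/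
theorem exists_dyadicEnergySup_le_exp :
    ∃ K : ℝ≥0, ∀ (S : Set ℝ) (ν : ℝ) (u : ℝ → EuclideanSpace ℝ (Fin 3) → EuclideanSpace ℝ (Fin 3))
      (p : ℝ → EuclideanSpace ℝ (Fin 3) → ℝ) (f : ℝ → ℝ) (E₀ : ℝ≥0∞),
      IsClassicalNSSolutionOn S ν 0 u p → IsOpen S → 0 ≤ ν →
      (∀ᵐ τ ∂(volume.restrict S), ∃ c : ℝ, ∀ x, p τ x - c = normalisedPressure (u τ) x) →
      (∀ τ ∈ S, MemLp (u τ) 2 volume) → (∀ τ ∈ S, ∀ x, ‖u τ x‖ ≤ f τ) →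
      E₀ ≠ ⊤ → (∀ τ ∈ S, ∫⁻ y, ‖u τ y‖ₑ ^ 2 ≤ E₀) →
      ∀ (x₀ : EuclideanSpace ℝ (Fin 3)) (R s t₁ : ℝ), 0 < R → s ≤ t₁ → Icc s t₁ ⊆ S →
        (∫⁻ τ in Ioo s t₁, ENNReal.ofReal (f τ) ≠ ⊤) →
        ∀ t ∈ Icc s t₁, dyadicEnergySup (u t) x₀ R ≤
          8 * dyadicEnergySup (u s) x₀ R *
            ENNReal.ofReal (Real.exp (∫⁻ τ in Ioo s t,
              K * (ENNReal.ofReal (|ν| / R ^ 2) + ENNReal.ofReal (f τ / R))).toReal) := by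
  obtain ⟨K, hK⟩ := exists_dyadicEnergySup_step
  refine ⟨K, fun S ν u p f E₀ hsol hS hν hgauge hL2 hf hE₀ hE x₀ R s t₁ hR hst₁ hI hfin t ht => ?_⟩
  set a : ℝ → ℝ≥0∞ := fun τ => K * (ENNReal.ofReal (|ν| / R ^ 2) + ENNReal.ofReal (f τ / R))
    with ha
  -- boundedness of the dyadic suprema by the energy
  have hWM : ∀ τ ∈ Icc s t₁, dyadicEnergySup (u τ) x₀ R ≤ E₀ := fun τ hτ =>
    dyadicEnergySup_le_lintegral.trans (hE τ (hI hτ))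
  have hB : 8 * dyadicEnergySup (u s) x₀ R ≠ ⊤ :=
    ENNReal.mul_ne_top (by norm_num) (ne_top_of_le_ne_top hE₀ (hWM s (left_mem_Icc.2 hst₁)))
  -- finiteness of the kernel integral on the window
  have hker : ∫⁻ τ in Ioo s t₁, a τ ≠ ⊤ := by
    have hsplit : ∀ τ, a τ = K * ENNReal.ofReal (|ν| / R ^ 2) +
        (K * ENNReal.ofReal R⁻¹) * ENNReal.ofReal (f τ) := by
      intro τ
      rw [ha]
      simp only
      rw [mul_add, div_eq_mul_inv (f τ), ENNReal.ofReal_mul' (inv_nonneg.2 hR.le)]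
      ring
    simp_rw [hsplit]
    rw [lintegral_add_left' aemeasurable_const, lintegral_const_mul' _ _
      (ENNReal.mul_ne_top ENNReal.coe_ne_top ENNReal.ofReal_ne_top), lintegral_const,
      Measure.restrict_apply_univ, Real.volume_Ioo]
    exact ENNReal.add_ne_top.2 ⟨ENNReal.mul_ne_top (ENNReal.mul_ne_top ENNReal.coe_ne_top
      ENNReal.ofReal_ne_top) ENNReal.ofReal_ne_top,
      ENNReal.mul_ne_top (ENNReal.mul_ne_top ENNReal.coe_ne_top ENNReal.ofReal_ne_top) hfin⟩
  -- the integral inequality on the window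
  have hineq : ∀ τ ∈ Icc s t₁, dyadicEnergySup (u τ) x₀ R ≤
      8 * dyadicEnergySup (u s) x₀ R + ∫⁻ σ in Ioo s τ, a σ * dyadicEnergySup (u σ) x₀ R :=
    fun τ hτ => hK S ν u p f hsol hS hν hgauge hL2 hf x₀ R s τ hR hτ.1
      ((Icc_subset_Icc_right hτ.2).trans hI)
  exact lintegral_gronwall_le_Icc (φ := fun τ => dyadicEnergySup (u τ) x₀ R) (a := a) hB hE₀ hWM
    hker hineq t ht

end LeslieShvydkoy2018

end Literature.Analysis.FluidPDE

end
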